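import Mathlib
import Summits.AtomisticToContinuum.Crystallization.Theorems.ThreeConeCertificateExactCertificateTransfer1DClassBounds

/-!
# Crux `ExactCertificate` (stmt-AtomisticToContinuum-11959), line `closure-makes-nogap-exact`,
# Transfer skeleton VII (`OneCrossingChainCrystallizes`): stub `stub_chainEnergy_tendsto_zero_right`

Support file for the crux `ThreeConeCertificate.ExactCertificate`, d = 1 Transfer skeleton VII
(`Cruxes.ExactCertificate.Transfer1D.OneCrossingChainCrystallizes`: a zero-pressure spacing EXISTS for
the one-crossing Laplace class with a repulsive core).  This file proves the registered stub
`stub_chainEnergy_tendsto_zero_right` — THE CHAIN COLLAPSES ENERGETICALLY AT SMALL SPACING: for a pair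
potential `V(r) = −∫₀^∞ e^{−tr} p(t) dt` with the envelope `|p(t)| ≤ C(t² + t^M)` (`M ≥ 2`) and a
repulsive core `c r⁻² ≤ V(r)` on `(0, r₀]` (`c, r₀ > 0`), the chain energy `e(b) = Σ_{k ≥ 0} V((k+1) b)`
tends to `+∞` as `b → 0⁺`.

Proof.  For `0 < b ≤ r₀/2` every partial sum (from the second term on) of the absolutely convergent
series (`classBounds_summable`) is `≥ −K b⁻¹`, `K := 2 C₂ / r₀`, `C₂ := C (2 r₀⁻¹ + M! r₀^{−(M−1)})`,
while the first term is `V(b) ≥ c b⁻²` (core):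
* a term `V(x)`, `x = (i+2) b`, is `≥ 0` if `x ≤ r₀` (core) and `≥ −|V(x)| ≥ −C₂ x⁻²` if `x > r₀`
  (the decay `|V(x)| ≤ C(2x⁻³ + M! x^{−(M+1)})` of `classBounds_abs_le` and `x⁻¹ ≤ r₀⁻¹`,
  `zcoll_abs_le_inv_sq`);
* both cases are dominated by the TELESCOPING differences `u_{i+1} − u_i ≤ V((i+2) b)` of
  `u_i := (C₂/b) · (max (r₀ − b) ((i+1) b))⁻¹ ≥ 0` (non-increasing, constant while `(i+2) b ≤ r₀`, and
  `C₂ x⁻² ≤ C₂ / (b² (i+1)(i+2)) = u_i − u_{i+1}` beyond), so the tail is `≥ u_m − u_0 ≥ −u_0 ≥ −K b⁻¹`.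
Hence `e(b) ≥ c b⁻² − K b⁻¹ = b⁻¹ (c b⁻¹ − K) → +∞` as `b → 0⁺` (`ge_of_tendsto` on the partial sums,
`tendsto_inv_nhdsGT_zero`, `Tendsto.atTop_mul_atTop₀`, `tendsto_atTop_mono'`).  Helper lemma prefixed
`zcoll_`.  All `[folklore]`; no named facts are used.
-/

noncomputable section

namespace Summit.AtomisticToContinuum.Crystallization.Theorems.ThreeConeCertificateExactCertificate.Transfer1D

open Literature.MathematicalPhysics.StatisticalMechanics MeasureTheory Set Filter Topology
open scoped BigOperators

/-- Tail decay in inverse-square form: under the envelope and the Laplace representation, for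
`x > r₀ > 0`, `|V(x)| ≤ C (2 r₀⁻¹ + M! r₀^{−(M−1)}) · x⁻²` (from `|V(x)| ≤ C(2x⁻³ + M! x^{−(M+1)})`,
`classBounds_abs_le`, and `x⁻¹ ≤ r₀⁻¹`). [folklore] -/
theorem zcoll_abs_le_inv_sq {V p : ℝ → ℝ} {C : ℝ} {M : ℕ} (hM : 2 ≤ M) (hpm : Measurable p)
    (hbd : ∀ t : ℝ, 0 < t → |p t| ≤ C * (t ^ 2 + t ^ M))
    (hV : ∀ r : ℝ, 0 < r → V r = -(∫ t in Set.Ioi (0 : ℝ), Real.exp (-(t * r)) * p t))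
    {r₀ x : ℝ} (hr₀ : 0 < r₀) (hx : r₀ < x) :
    |V x| ≤ C * (2 * r₀⁻¹ + (M.factorial : ℝ) * r₀⁻¹ ^ (M - 1)) * x⁻¹ ^ 2 := by
  have hx0 : 0 < x := hr₀.trans hx
  have hC := classBounds_C_nonneg hbd
  have hinv : x⁻¹ ≤ r₀⁻¹ := inv_anti₀ hr₀ hx.le
  have hinv0 : 0 ≤ x⁻¹ := inv_nonneg.2 hx0.le
  have hsq : 0 ≤ x⁻¹ ^ 2 := pow_nonneg hinv0 2
  have h3 : x⁻¹ ^ 3 ≤ r₀⁻¹ * x⁻¹ ^ 2 :=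
    calc x⁻¹ ^ 3 = x⁻¹ * x⁻¹ ^ 2 := by ring
      _ ≤ r₀⁻¹ * x⁻¹ ^ 2 := mul_le_mul_of_nonneg_right hinv hsq
  have hM1 : x⁻¹ ^ (M + 1) ≤ r₀⁻¹ ^ (M - 1) * x⁻¹ ^ 2 := by
    rw [show M + 1 = (M - 1) + 2 by omega, pow_add]
    exact mul_le_mul_of_nonneg_right (pow_le_pow_left₀ hinv0 hinv _) hsq
  have hf : (0 : ℝ) ≤ M.factorial := Nat.cast_nonneg _
  calc |V x| ≤ C * (2 * x⁻¹ ^ 3 + (M.factorial : ℝ) * x⁻¹ ^ (M + 1)) :=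
        classBounds_abs_le hpm hbd hV hx0
    _ ≤ C * (2 * (r₀⁻¹ * x⁻¹ ^ 2) + (M.factorial : ℝ) * (r₀⁻¹ ^ (M - 1) * x⁻¹ ^ 2)) :=
        mul_le_mul_of_nonneg_left (add_le_add (mul_le_mul_of_nonneg_left h3 zero_le_two)
          (mul_le_mul_of_nonneg_left hM1 hf)) hC
    _ = C * (2 * r₀⁻¹ + (M.factorial : ℝ) * r₀⁻¹ ^ (M - 1)) * x⁻¹ ^ 2 := by ring

/-- **STUB Z3b `stub_chainEnergy_tendsto_zero_right` — THE CHAIN COLLAPSES ENERGETICALLY AT SMALL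
SPACING** (registered stub of Transfer skeleton VII): for `V(r) = −∫₀^∞ e^{−tr} p(t) dt` with `p`
measurable, the envelope `|p(t)| ≤ C(t² + t^M)` (`M ≥ 2`) and a repulsive core `c r⁻² ≤ V(r)` on
`(0, r₀]` (`c, r₀ > 0`), the chain energy `b ↦ Σ_k V((k+1) b)` tends to `+∞` as `b → 0⁺`: the first
term is `≥ c b⁻²`, the terms inside `r₀` are `≥ 0`, and the tail beyond `r₀` is `≥ −K b⁻¹`
(`|V(x)| ≤ C₂ x⁻²` there, telescoped against `u_i = (C₂/b) (max (r₀ − b) ((i+1) b))⁻¹`). [folklore] -/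
theorem stub_chainEnergy_tendsto_zero_right : ∀ (V p : ℝ → ℝ) (C c r₀ : ℝ) (M : ℕ), 2 ≤ M → Measurable p →
    (∀ t : ℝ, 0 < t → |p t| ≤ C * (t ^ 2 + t ^ M)) →
    (∀ r : ℝ, 0 < r → V r = -(∫ t in Set.Ioi (0 : ℝ), Real.exp (-(t * r)) * p t)) →
    0 < c → 0 < r₀ → (∀ r : ℝ, 0 < r → r ≤ r₀ → c * r⁻¹ ^ 2 ≤ V r) →
    Filter.Tendsto (fun b : ℝ => ∑' k : ℕ, V (((k : ℝ) + 1) * b)) (nhdsWithin 0 (Set.Ioi 0)) Filter.atTop := by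
  intro V p C c r₀ M hM hpm hbd hV hc hr₀ hcore
  have hC := classBounds_C_nonneg hbd
  -- the tail constants
  obtain ⟨C₂, hC₂⟩ : ∃ C₂ : ℝ, C₂ = C * (2 * r₀⁻¹ + (M.factorial : ℝ) * r₀⁻¹ ^ (M - 1)) := ⟨_, rfl⟩
  have hC₂0 : 0 ≤ C₂ := by rw [hC₂]; positivity
  obtain ⟨K, hK⟩ : ∃ K : ℝ, K = 2 * C₂ / r₀ := ⟨_, rfl⟩
  -- Step 1: the lower bound `c b⁻² − K b⁻¹ ≤ e(b)` for `0 < b ≤ r₀ / 2`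
  have hlow : ∀ b : ℝ, 0 < b → b ≤ r₀ / 2 →
      c * b⁻¹ ^ 2 - K * b⁻¹ ≤ ∑' k : ℕ, V (((k : ℝ) + 1) * b) := by
    intro b hb hbr
    have hs : Summable (fun k : ℕ => V (((k : ℝ) + 1) * b)) := by
      have h := classBounds_summable hM hpm hbd hV hb (le_refl (0 : ℝ))
      simpa only [zero_add] using h
    have hρ0 : 0 < r₀ - b := by linarith
    have hCb : 0 ≤ C₂ / b := div_nonneg hC₂0 hb.le
    -- the telescoping majorant `u`
    obtain ⟨u, hu⟩ : ∃ u : ℕ → ℝ, ∀ i : ℕ,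
        u i = C₂ / b * (max (r₀ - b) (((i : ℝ) + 1) * b))⁻¹ := ⟨_, fun _ => rfl⟩
    have hu0 : ∀ i : ℕ, 0 ≤ u i := fun i => by
      rw [hu i]
      exact mul_nonneg hCb (inv_nonneg.2 (hρ0.le.trans (le_max_left _ _)))
    -- termwise: `u (i+1) − u i ≤ V((i+2) b)`
    have hpt : ∀ i : ℕ, u (i + 1) - u i ≤ V ((((i + 1 : ℕ) : ℝ) + 1) * b) := by
      intro i
      rw [hu (i + 1), hu i, Nat.cast_succ]
      have hx0 : 0 < ((i : ℝ) + 1 + 1) * b := by positivity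
      rcases le_or_gt (((i : ℝ) + 1 + 1) * b) r₀ with hle | hlt
      · -- inside the core: the term is `≥ 0` and `u` is non-increasing
        have hVx : 0 ≤ V (((i : ℝ) + 1 + 1) * b) := le_trans (by positivity) (hcore _ hx0 hle)
        have hmono : (max (r₀ - b) (((i : ℝ) + 1 + 1) * b))⁻¹ ≤
            (max (r₀ - b) (((i : ℝ) + 1) * b))⁻¹ :=
          inv_anti₀ (lt_max_of_lt_left hρ0) (max_le_max le_rfl (by nlinarith))
        have hmul := mul_le_mul_of_nonneg_left hmono hCb
        linarith
      · -- beyond the core: `−C₂ x⁻² ≤ V x`, paid for by the telescoping step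
        have h1 : r₀ - b ≤ ((i : ℝ) + 1) * b := by linarith
        have h2 : r₀ - b ≤ ((i : ℝ) + 1 + 1) * b := by linarith
        rw [max_eq_right h1, max_eq_right h2]
        have hVge : -(C₂ * (((i : ℝ) + 1 + 1) * b)⁻¹ ^ 2) ≤ V (((i : ℝ) + 1 + 1) * b) := by
          have ha := zcoll_abs_le_inv_sq hM hpm hbd hV hr₀ hlt
          rw [← hC₂] at ha
          have hn := neg_abs_le (V (((i : ℝ) + 1 + 1) * b))
          linarith
        have hab : 0 < ((i : ℝ) + 1) * b := by positivity
        have hsq : (((i : ℝ) + 1 + 1) * b)⁻¹ ^ 2 ≤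
            (((i : ℝ) + 1) * b)⁻¹ * (((i : ℝ) + 1 + 1) * b)⁻¹ := by
          rw [sq]
          exact mul_le_mul_of_nonneg_right (inv_anti₀ hab (by nlinarith)) (inv_nonneg.2 hx0.le)
        have hi0 : (i : ℝ) + 1 ≠ 0 := by positivity
        have hi1 : (i : ℝ) + 1 + 1 ≠ 0 := by positivity
        have hb0 : b ≠ 0 := hb.ne'
        have hid : C₂ / b * (((i : ℝ) + 1 + 1) * b)⁻¹ - C₂ / b * (((i : ℝ) + 1) * b)⁻¹ =
            -(C₂ * ((((i : ℝ) + 1) * b)⁻¹ * (((i : ℝ) + 1 + 1) * b)⁻¹)) := by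
          field_simp
          ring
        rw [hid]
        exact le_trans (neg_le_neg (mul_le_mul_of_nonneg_left hsq hC₂0)) hVge
    -- the first term: `V(b) ≥ c b⁻²`
    have hfirst : c * b⁻¹ ^ 2 ≤ V ((((0 : ℕ) : ℝ) + 1) * b) := by
      rw [Nat.cast_zero, zero_add, one_mul]
      exact hcore b hb (by linarith)
    -- `u 0 ≤ K b⁻¹`
    have hu0K : u 0 ≤ K * b⁻¹ := by
      rw [hu 0, Nat.cast_zero, zero_add, one_mul]
      have hmax : r₀ / 2 ≤ max (r₀ - b) b := le_trans (by linarith) (le_max_left _ _)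
      have h1 : (max (r₀ - b) b)⁻¹ ≤ (r₀ / 2)⁻¹ := inv_anti₀ (by positivity) hmax
      calc C₂ / b * (max (r₀ - b) b)⁻¹ ≤ C₂ / b * (r₀ / 2)⁻¹ := mul_le_mul_of_nonneg_left h1 hCb
        _ = K * b⁻¹ := by rw [hK]; ring
    -- pass to the limit of the partial sums
    refine ge_of_tendsto hs.tendsto_sum_tsum_nat (Filter.eventually_atTop.2 ⟨1, fun n hn => ?_⟩)
    obtain ⟨m, rfl⟩ := Nat.exists_eq_add_of_le' hn
    rw [Finset.sum_range_succ']
    have htail : u m - u 0 ≤ ∑ i ∈ Finset.range m, V ((((i + 1 : ℕ) : ℝ) + 1) * b) :=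
      calc u m - u 0 = ∑ i ∈ Finset.range m, (u (i + 1) - u i) := (Finset.sum_range_sub u m).symm
        _ ≤ ∑ i ∈ Finset.range m, V ((((i + 1 : ℕ) : ℝ) + 1) * b) :=
          Finset.sum_le_sum fun i _ => hpt i
    have hum := hu0 m
    linarith
  -- Step 2: `c b⁻² − K b⁻¹ = b⁻¹ (c b⁻¹ − K) → +∞` as `b → 0⁺`
  have hinv : Tendsto (fun b : ℝ => b⁻¹) (nhdsWithin 0 (Set.Ioi 0)) atTop := tendsto_inv_nhdsGT_zero
  have h2 : Tendsto (fun b : ℝ => b⁻¹ * (c * b⁻¹ + -K)) (nhdsWithin 0 (Set.Ioi 0)) atTop :=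
    hinv.atTop_mul_atTop₀ (tendsto_atTop_add_const_right _ (-K) (hinv.const_mul_atTop hc))
  refine tendsto_atTop_mono' _ ?_ h2
  filter_upwards [Ioc_mem_nhdsGT (half_pos hr₀)] with b hb
  exact (hlow b hb.1 hb.2).trans_eq' (by ring)

end Summit.AtomisticToContinuum.Crystallization.Theorems.ThreeConeCertificateExactCertificate.Transfer1D

end
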